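import Literature.IUT.HodgeArakelov.ThetaEvaluationModelEvProofs
import Literature.IUT.HodgeArakelov.PointedInversionOfSetting

/-!
# [IUTchII] Cor 1.12 (ii) at the model WITH THE MODEL POINTED INVERSION (abc-iut-w5-d072's `pointedInversionOfPair`):
# the input `hres` discharged — proof companion

Proof-only companion (abc-iut cell, D-0067 wave 4, seat abc-iut-w4-d043 gen 2; L6-lead ruling §F v1.18c (1); SUBDAG
`plan/L6/SUBDAG-IUTchII-Cor-112.md` row Cor-112.ii.r13; node **IUTchII:Cor1.12(ii)**) to `ThetaEvaluationModelEvProofs.lean`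
(Cor. 1.12 (ii) for the model theta-evaluation datum) and to abc-iut-w5-d072's `PointedInversionOfSetting.lean` (p418896: the
RELATIVE inhabitant `pointedInversionOfPair` of abc-iut-L6-t1's `PointedInversion` at the model, with
`HDmu := H¹(D_{μ_-}, (l·Δ_Θ))` REAL and `resDmu := ContH1.res ∘ h1Top`). No definitions.

S. Mochizuki, *Inter-universal Teichmüller theory II*, kurims manuscript (Dec. 2020), Cor. 1.12 (ii) p. 57, Rmk. 1.4.1 (ii)
pp. 28–29. Claim key `Mochizuki2012` (D-0012, DISPUTED); nothing here takes a side on [IUTchIII] Cor. 3.12.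

PROVED:
* `EtaleLevels.isOfFinAddOrder_h1LimRestrict_toLim_of_resDmuOf` — the input `hres` of `cor112_ii_thetaEvaluation*` HOLDS when
  the pointed inversion's restriction datum is the genuine `resDmuOf` (restriction `H¹(Π_Ÿ(Π), ·) → H¹(D_{μ_-}, ·)`): torsion of
  `res_{D_{μ_-}}(x)` implies torsion of `h1LimRestrict (toLim x)` (abc-iut-L6-t1's `h1LimRestrict_toLim`, `h1Equiv_h1LimRestrict`);
* **`EtaleLevels.cor112_ii_model`** — **[IUTchII] Cor. 1.12 (ii) at the model `Π := Π^tp_{X̲̲}` for the model pointed inversion**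
  `I := pointedInversionOfPair …` (its `ι` THE SAME automorphism `α` that acts on cohomology through `pairRhoLim (α, β)`), the
  model theta-evaluation datum over the canonical retractions of `ε` and the constants `ℚ̄_pˣ`: `Cor112_ii` HOLDS given EXACTLY
  the named print inputs of Rmk. 1.4.1 (ii) carried by `pointedInversionOfPair` (`hover`, `δ`/`hδ`/`hαα`, `γ`/`hγ`/`hαγ`, `huniq`,
  `Dmu`/`hDmu`/`hfixD`, `etaStd`/`hmem`/`hstd`), the decomposition-group facts (`hDq`, `hlift`, `hemb`), `hα`/`hβ`, `hfix`
  (cyclotome fixed points), `hμ` (Kummer theory of MLF; GAP G-w4d043-1) and the Prop. 2.2 (ii) translate inputs on `H¹`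
  (`τ` with `τ 0 = etaStd`, `hdesc`, `hrev` for `pairRho`, `hfree`) — the inputs `hD₁`/`hD₂`/`hι`/`hθ₀`/`hres`/`hN`/`hq`/`hψA`/`hαA`
  being DISCHARGED in the kernel.
Typed ≠ discharged for the listed inputs.
-/

noncomputable section

namespace Literature.IUT.HodgeArakelov

open Literature.AnabelianGeometry.EtaleTheta Literature.AnabelianGeometry.SemiGraphs CohomologySystemOfContH1
open scoped Literature.AnabelianGeometry.EtaleTheta

namespace EtaleLevels

variable {p : ℕ} [Fact p.Prime] {D : Literature.AnabelianGeometry.EtaleTheta.ThetaSetting p}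
  {E : D.EtaleThetaData} {l : ℕ} (C : E.DoubleUnderline l)

/-- **The input `hres` for the genuine restriction datum**: if `res_{D_{μ_-}}(x) ∈ H¹(D_{μ_-}, (l·Δ_Θ))` (abc-iut-w5-d072's
`resDmuOf`, REAL) is torsion, then so is the restriction of the image of `x` in the limit, `h1LimRestrict (toLim ⊤ x)`
(naturality `h1LimRestrict_toLim` and the level comparison `h1Equiv_h1LimRestrict` of abc-iut-L6-t1).
[claim: Mochizuki2012, status: disputed] (IUTchII §1 Cor 1.12 (ii), kurims p.57) -/
theorem isOfFinAddOrder_h1LimRestrict_toLim_of_resDmuOf (Dmu : Subgroup (EtaleThetaDataOfSetting.Pi C))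
    (hDmu : Dmu ≤ EtaleThetaDataOfSetting.PiYdd C) (x : (EtaleThetaDataOfSetting.coh C).H1 ⊤)
    (hx : IsOfFinAddOrder (EtaleThetaDataOfSetting.resDmuOf C Dmu hDmu x)) :
    IsOfFinAddOrder (h1LimRestrict (EtaleThetaDataOfSetting.phi C) (D.lDeltaTheta l) hDmu ⊥
      ((EtaleThetaDataOfSetting.coh C).toLim ⊤ x)) := by
  -- the level-`⊤` restriction `h1LimRestrict hDmu ⊤ x` is torsion: compare with `res` through the equivalences
  have h0 := (MonoidHom.toAdditive (ContH1.res (EtaleThetaDataOfSetting.phi C) (D.lDeltaTheta l)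
    (inf_le_left : Dmu ⊓ (⊤ : Subgroup (EtaleThetaDataOfSetting.Pi C)) ≤ Dmu))).isOfFinAddOrder hx
  have h1 : MonoidHom.toAdditive (ContH1.res (EtaleThetaDataOfSetting.phi C) (D.lDeltaTheta l)
        (inf_le_left : Dmu ⊓ (⊤ : Subgroup (EtaleThetaDataOfSetting.Pi C)) ≤ Dmu))
        (EtaleThetaDataOfSetting.resDmuOf C Dmu hDmu x) =
      MonoidHom.toAdditive (ContH1.res (EtaleThetaDataOfSetting.phi C) (D.lDeltaTheta l)
        (inf_le_inf_right ⊤ hDmu)) (h1EquivOfFiniteIndexOpen (EtaleThetaDataOfSetting.phi C) (D.lDeltaTheta l)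
          (EtaleThetaDataOfSetting.PiYdd C) ⊤ inferInstance (by simp) x) := by
    change Additive.ofMul (ContH1.res _ _ _ (ContH1.res _ _ _ (Additive.toMul _))) =
      Additive.ofMul (ContH1.res _ _ _ (Additive.toMul _))
    rw [ContH1.res_res]
    rfl
  rw [h1, ← h1Equiv_h1LimRestrict (EtaleThetaDataOfSetting.phi C) (D.lDeltaTheta l) hDmu ⊤ inferInstance (by simp)] at h0
  have h2 : IsOfFinAddOrder (h1LimRestrict (EtaleThetaDataOfSetting.phi C) (D.lDeltaTheta l) hDmu ⊤ x) :=
    ((h1EquivOfFiniteIndexOpen (EtaleThetaDataOfSetting.phi C) (D.lDeltaTheta l) Dmu ⊤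
      inferInstance (by simp)).injective.isOfFinAddOrder_iff).mp h0
  -- pass to the limit: `h1LimRestrict ⊥ ∘ toLim ⊤ = toLim ⊤ ∘ h1LimRestrict ⊤`
  have h3 := ((cohomologySystemOfContH1 (EtaleThetaDataOfSetting.phi C) (D.lDeltaTheta l) Dmu).toLim ⊤).isOfFinAddOrder
    h2
  rw [← h1LimRestrict_toLim] at h3
  exact h3

variable (hC : D.Compat) (hS : D.Sec2Hyps)
  (hl : l.Prime) (hp2 : p ≠ 2) (hpl : p ≠ l) (hζ : ∃ ζ : D.K, IsPrimitiveRoot ζ (4 * l))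
  (mods : ∀ M : ℕ+, D.CyclotomeMod l M)
  (f : contCocycles D.toTheta D.DeltaTheta C.GtpYdduu) (hf : f ∈ C.rootCocycles hC)
  (hmods : ∀ (M M' : ℕ+) (h : (M : ℕ) ∣ (M' : ℕ)) (x : D.lDeltaTheta l),
    MuN.red p M M' h ((mods M').red x) = (mods M).red x)
  (h15 : Literature.AnabelianGeometry.EtaleTheta.ThetaSetting.Prop15iii E hC) (L : C.CuspLabels)
  (hZ : ∀ M : ℕ+, Nonempty (ModelCyclotomes.lDeltaQuot (C.rigidData (mods M) hC hS h15 L) ≃*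
    Literature.IUT.HodgeTheaters.ZHat))
  (hcharY : EtaleThetaDataOfSetting.PiYddCharacteristic C)
  (hlim : Function.Bijective (rigidLimHom C hC hS hl hp2 hpl hζ mods f hf hmods h15 L hZ))
  (Env : EnvOfGroup (setting C hC hS hl hp2 hpl hζ mods f hf)
    (modelSystem C hC hS hl hp2 hpl hζ mods f hf hmods h15 L hZ).PiX)
  -- the model pointed inversion (abc-iut-w5-d072's `pointedInversionOfPair`): its named print inputs
  (α : (EtaleThetaDataOfSetting.Pi C) ≃ₜ* (EtaleThetaDataOfSetting.Pi C))
  (hover : ∀ x : EtaleThetaDataOfSetting.Pi C, Env.recon.projG (Env.isoX (α x)) = Env.recon.projG (Env.isoX x))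
  (δ : EtaleThetaDataOfSetting.Pi C) (hδ : Env.recon.projG (Env.isoX δ) = 1)
  (hαα : ∀ x : EtaleThetaDataOfSetting.Pi C, α (α x) = δ * x * δ⁻¹)
  (γ : EtaleThetaDataOfSetting.Pi C) (hγ : C.toLZ γ = Multiplicative.ofAdd 1)
  (hαγ : C.toLZ (α γ) = Multiplicative.ofAdd (-1))
  (huniq : ∀ κ : (EtaleThetaDataOfSetting.Pi C) ≃ₜ* (EtaleThetaDataOfSetting.Pi C),
    (∀ x, Env.recon.projG (Env.isoX (κ x)) = Env.recon.projG (Env.isoX x)) →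
    (∃ δ' : EtaleThetaDataOfSetting.Pi C, Env.recon.projG (Env.isoX δ') = 1 ∧ ∀ x, κ (κ x) = δ' * x * δ'⁻¹) →
    (¬ ∃ δ' : EtaleThetaDataOfSetting.Pi C, Env.recon.projG (Env.isoX δ') = 1 ∧ ∀ x, κ x = δ' * x * δ'⁻¹) →
      ∃ δ' : EtaleThetaDataOfSetting.Pi C, Env.recon.projG (Env.isoX δ') = 1 ∧ ∀ x, κ x = δ' * α x * δ'⁻¹)
  (Dmu : Subgroup (EtaleThetaDataOfSetting.Pi C)) (hDmu : Dmu ≤ EtaleThetaDataOfSetting.PiYdd C)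
  (hfixD : ∃ δ' : ↥(EtaleThetaDataOfSetting.PiYdd C), Env.recon.projG (Env.isoX (δ' : EtaleThetaDataOfSetting.Pi C)) = 1 ∧
    ∀ (d : EtaleThetaDataOfSetting.Pi C) (hd : d ∈ Dmu), ((EtaleThetaDataOfSetting.iotaYddOfAut C hcharY α ⟨d, hDmu hd⟩ :
      EtaleThetaDataOfSetting.PiYdd C) : EtaleThetaDataOfSetting.Pi C) ∈
        Dmu.map (MulAut.conj ((δ' : EtaleThetaDataOfSetting.PiYdd C) : EtaleThetaDataOfSetting.Pi C)).toMonoidHom)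
  (etaStd : (EtaleThetaDataOfSetting.coh C).H1 ⊤) (hmem : etaStd ∈ EtaleThetaDataOfSetting.orbitOne C hC)
  (hstd : (2 * (setting C hC hS hl hp2 hpl hζ mods f hf).l) • EtaleThetaDataOfSetting.resDmuOf C Dmu hDmu etaStd = 0)
  -- the coefficient half of the pair and its printed properties
  (β : D.GtpTheta ≃ₜ* D.GtpTheta)
  (hφ : ∀ g, β (EtaleThetaDataOfSetting.phi C g) = EtaleThetaDataOfSetting.phi C (α g))
  (hAβ : ∀ a : D.GtpTheta, a ∈ D.lDeltaTheta l ↔ β a ∈ D.lDeltaTheta l)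
  (hH : ∀ x, x ∈ EtaleThetaDataOfSetting.PiYdd C ↔ α x ∈ EtaleThetaDataOfSetting.PiYdd C)
  -- decomposition-group facts, constants
  (hDq : ∀ d ∈ Dmu, EtaleThetaDataOfSetting.aug C d = 1 → d = 1)
  (hlift : ∀ K : Subgroup (EtaleThetaDataOfSetting.Pi C), K.FiniteIndex → IsOpen (K : Set (EtaleThetaDataOfSetting.Pi C)) →
    (liftSubgroup (EtaleThetaDataOfSetting.aug C) Dmu K).FiniteIndex ∧
      IsOpen (liftSubgroup (EtaleThetaDataOfSetting.aug C) Dmu K : Set (EtaleThetaDataOfSetting.Pi C)))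
  (hemb : ∀ K : Subgroup (EtaleThetaDataOfSetting.Pi C),
    Topology.IsEmbedding fun d : ↥(Dmu ⊓ K) => EtaleThetaDataOfSetting.aug C d.1)
  (cU : CyclotomeCoefficients (EtaleThetaDataOfSetting.phi C) (D.lDeltaTheta l) (PadicAlgCl p)ˣ)
  (Uu : Subgroup (PadicAlgCl p)ˣ)

/-- **[IUTchII] Cor. 1.12 (ii) at the model, for the MODEL POINTED INVERSION.** Over `Π := Π^tp_{X̲̲}` with REAL continuous
cohomology of `(l·Δ_Θ)`, abc-iut-w4-d030's `θ_env`-data, abc-iut-w5-d072's RELATIVE pointed inversion `pointedInversionOfPair`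
(its `ι = α`, `D_{μ_-} = Dmu`, `η_std = etaStd`, `resDmu` the genuine restriction), the theta-evaluation datum
`EtaleLevels.thetaEvaluation` (inflation section of the canonical retractions of `ε`, constants `ℚ̄_pˣ ⊇ U` through `ε`, `iotaLim :=
pairRhoLim (α, β)`): the typed `Cor112_ii` HOLDS, given exactly the NAMED print inputs listed in the section variables and binders
(Rmk. 1.4.1 (ii) data; `D ∩ Δ = 1` & the topological facts on `D_{μ_-}`; `α` over `G_k`, `β` trivial on `(l·Δ_Θ)`; the cyclotome
fixed-point fact `hfix`; Kummer theory of MLF `hμ`; the Prop. 2.2 (ii) translate inputs `τ`/`hτ`/`hdesc`/`hrev`/`hfree` on `H¹`).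
Discharged in the kernel: `hD₁`/`hD₂` (inflation section), `hι` (the pair fixes Kummer classes of constants), `hθ₀` (translates +
`PointedInversion.standard`), `hres` (genuine `resDmuOf`), `hN`/`hq`/`hψA`/`hαA` (structure of `ε`).
[claim: Mochizuki2012, status: disputed] (IUTchII §1 Cor 1.12 (ii), kurims pp.56-58) -/
theorem cor112_ii_model
    (hα : ∀ x, EtaleThetaDataOfSetting.aug C (α x) = EtaleThetaDataOfSetting.aug C x)
    (hβ : ∀ a : D.GtpTheta, a ∈ D.lDeltaTheta l → β a = a)
    (hfix : ∀ K' : Subgroup (EtaleThetaDataOfSetting.Pi C), K'.FiniteIndex →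
      ∀ a : D.lDeltaTheta l, (∀ n : EtaleThetaDataOfSetting.Pi C, n ∈ EtaleThetaDataOfSetting.PiYdd C ⊓ K' →
        MulAut.conjNormal (EtaleThetaDataOfSetting.phi C n) a = a) → a = 1)
    (hμ : ∀ y : h1Lim (EtaleThetaDataOfSetting.phi C) (D.lDeltaTheta l) Dmu ⊥, IsOfFinAddOrder y →
      y ∈ (thetaEvaluation C hC hS hl hp2 hpl hζ mods f hf hmods h15 L hZ hcharY hlim Env
        (EtaleThetaDataOfSetting.pointedInversionOfPair C hC hS hcharY (setting C hC hS hl hp2 hpl hζ mods f hf)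
          (ContinuousMulEquiv.refl _) rfl Env α hover δ hδ hαα γ hγ hαγ huniq Dmu hDmu hfixD etaStd hmem hstd)
        (LevelRetraction.ofAugmentation (EtaleThetaDataOfSetting.phi C) (D.lDeltaTheta l)
          (EtaleThetaDataOfSetting.aug C) Dmu hDq (EtaleThetaDataOfSetting.PiYdd C)
          (EtaleThetaDataOfSetting.continuous_aug C) (aug_ker_acts_trivially C) hlift hemb)
        cU (EtaleThetaDataOfSetting.isOpen_stabilizer_units C) (EtaleThetaDataOfSetting.finiteIndex_stabilizer_units C)
        Uu (EtaleThetaDataOfSetting.pairRhoLim C α β hφ hAβ hH)).MxTM)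
    (τ : ℤ → (EtaleThetaDataOfSetting.coh C).H1 ⊤) (hτ : τ 0 = etaStd)
    (hdesc : ∀ o ∈ EtaleThetaDataOfSetting.orbitOne C hC,
      ∃ (n : ℤ) (c' : (EtaleThetaDataOfSetting.coh C).H1 ⊤), 2 • c' = 0 ∧ o = τ n + c')
    (hrev : ∀ n : ℤ, IsOfFinAddOrder (EtaleThetaDataOfSetting.pairRho C α β hφ hAβ hH (τ n) - τ (-n)))
    (hfree : ∀ m n : ℤ, IsOfFinAddOrder (τ m - τ n) → m = n) :
    Literature.IUT.HodgeArakelov.Cor112_ii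
      (thetaEvaluation C hC hS hl hp2 hpl hζ mods f hf hmods h15 L hZ hcharY hlim Env
        (EtaleThetaDataOfSetting.pointedInversionOfPair C hC hS hcharY (setting C hC hS hl hp2 hpl hζ mods f hf)
          (ContinuousMulEquiv.refl _) rfl Env α hover δ hδ hαα γ hγ hαγ huniq Dmu hDmu hfixD etaStd hmem hstd)
        (LevelRetraction.ofAugmentation (EtaleThetaDataOfSetting.phi C) (D.lDeltaTheta l)
          (EtaleThetaDataOfSetting.aug C) Dmu hDq (EtaleThetaDataOfSetting.PiYdd C)
          (EtaleThetaDataOfSetting.continuous_aug C) (aug_ker_acts_trivially C) hlift hemb)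
        cU (EtaleThetaDataOfSetting.isOpen_stabilizer_units C) (EtaleThetaDataOfSetting.finiteIndex_stabilizer_units C)
        Uu (EtaleThetaDataOfSetting.pairRhoLim C α β hφ hAβ hH)) :=
  cor112_ii_thetaEvaluation_units_H1 C hC hS hl hp2 hpl hζ mods f hf hmods h15 L hZ hcharY hlim Env
    (EtaleThetaDataOfSetting.pointedInversionOfPair C hC hS hcharY (setting C hC hS hl hp2 hpl hζ mods f hf)
      (ContinuousMulEquiv.refl _) rfl Env α hover δ hδ hαα γ hγ hαγ huniq Dmu hDmu hfixD etaStd hmem hstd)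
    α β hφ hAβ hH hDq hlift hemb cU Uu hα hβ hfix hμ τ hτ hdesc hrev hfree
    (fun x hx => isOfFinAddOrder_h1LimRestrict_toLim_of_resDmuOf C Dmu hDmu x hx)

end EtaleLevels

end Literature.IUT.HodgeArakelov
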